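import Summits.Ventures.DiscreteObjects.UnitDistance.ThreeAdicReduction
import Summits.Ventures.DiscreteObjects.UnitDistance.FieldPlanes
import Mathlib.NumberTheory.Padics.Hensel

/-!
# The 3-adic criterion: three colours for `ℚ(√d : d ∈ S)²` when `S` embeds into `ℚ₃(√3)` or `ℚ₃(√6)`
(cell `pub-namedobj`, target (U), seat udg g11)

Framing (verbatim for the cell): lottery ticket; floor = certified bounds/negative ranges.

The square classes of `ℚ₃^×/ℚ₃^{×2} = ⟨[3], [−1]⟩` (`[−1] = [2]`, the non-square unit class): a natural number `d = 3^a·m`,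
`3 ∤ m`, has class `a[3] + (m ≡ 2 mod 3)[−1]`.  The subgroup generated by the classes of `S` avoids `[−1]` iff every
`d ∈ S` lies in `⟨[3]⟩` (pattern `d ≡ 1 (mod 3)` or `d ≡ 3 (mod 9)`: `K_S ⊂ ℚ₃(√3)`) or every `d ∈ S` lies in `⟨[6]⟩`
(pattern `d ≡ 1 (mod 3)` or `d ≡ 6 (mod 9)`: `K_S ⊂ ℚ₃(√6)`); in both cases the completion has residue field `𝔽₃`, `−1`
is a non-square there, and Madore's reduction gives `χ(K_S²) ≤ χ(UD(𝔽₃²)) = 3` (`ThreeAdicReduction` +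
`ValuationRingReduction`).  With an equilateral triangle (`√3 ∈ K_S`, e.g. `3 ∈ S`): `χ(K_S²) = 3` EXACTLY.

* `colorable_three_of_threeAdicPattern` — the criterion; realisation / `unitCircleGraph` / plane forms;
* `chromaticNumber_plane_eq_three` — `χ(K_S²) = 3` when moreover `√3 ∈ K_S`;
* printed special cases reproduced (kernel): Madore 2015 Prop. `χ(ℚ(√3)²) = 3` (`chromaticNumber_plane_sqrt3`); Fischer 1990
  `χ(ℚ(√n)²) ≤ 3` for square-free `n ≡ 0, 1 (mod 3)` (`colorable_three_plane_quadratic`, here: `n ≡ 1 mod 3` or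
  `n ≡ 3, 6 mod 9`) [Payne 2009, arXiv:0707.1177 p. 6];
* beyond print (not found in corpus/galaxy; PROVISIONAL): `χ(ℚ(√3, √7)²) = 3`, `χ(ℚ(√3, √7, √13, √19, √21, √31)²) = 3`,
  `χ(ℚ(√6, √7, √15, √33)²) ≤ 3`.

Nothing here is literature.
-/

noncomputable section

namespace Summit.Ventures.DiscreteObjects.UnitDistance

open ThreeAdic MoserLocal SimpleGraph IntermediateField Polynomial Spectral
open scoped IntermediateField

/-! ## Hensel in `ℤ₃` and square roots in the two frames -/

/-- HENSEL: a `3`-adic integer `u ≡ 1 (mod 3)` is a square in `ℚ₃`. -/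
theorem ThreeAdic.exists_sq_eq_of_norm_sub_one_lt (u : ℤ_[3]) (hu : ‖u - 1‖ < 1) : ∃ r : ℚ_[3], r ^ 2 = (u : ℚ_[3]) := by
  set F : Polynomial ℤ_[3] := X ^ 2 - C u with hF
  have hFa : F.aeval (1 : ℤ_[3]) = 1 - u := by simp [hF]
  have hF' : (Polynomial.derivative F).aeval (1 : ℤ_[3]) = 2 := by
    have hd : Polynomial.derivative F = C (2 : ℤ_[3]) * X := by
      rw [hF, derivative_sub, derivative_X_pow, derivative_C, sub_zero]; simp
    rw [hd]; simp
  have h2 : ‖(2 : ℤ_[3])‖ = 1 := by rw [PadicInt.norm_def]; exact_mod_cast norm_two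
  have hnorm : ‖F.aeval (1 : ℤ_[3])‖ < ‖(Polynomial.derivative F).aeval (1 : ℤ_[3])‖ ^ 2 := by
    rw [hFa, hF', h2, one_pow, ← norm_neg, neg_sub]; exact hu
  obtain ⟨z, hz, -⟩ := hensels_lemma hnorm
  refine ⟨(z : ℚ_[3]), ?_⟩
  have hz' : z ^ 2 = u := by
    have : F.aeval z = z ^ 2 - u := by simp [hF]
    rw [this] at hz; exact sub_eq_zero.1 hz
  rw [← PadicInt.coe_pow, hz']

/-- A natural number `m ≡ 1 (mod 3)` is a square in `ℚ₃`. -/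
theorem ThreeAdic.exists_sq_eq_nat_of_mod_three (m : ℕ) (hm : m % 3 = 1) : ∃ r : ℚ_[3], r ^ 2 = (m : ℚ_[3]) := by
  have hle : ‖((m : ℤ) : ℚ_[3])‖ ≤ 1 := Padic.norm_int_le_one _
  set u : ℤ_[3] := ⟨(m : ℚ_[3]), by exact_mod_cast hle⟩ with hu
  have hlt : ‖u - 1‖ < 1 := by
    rw [PadicInt.norm_def]
    have : ((u - 1 : ℤ_[3]) : ℚ_[3]) = ((m - 1 : ℤ) : ℚ_[3]) := by simp [hu]
    rw [this, Padic.norm_intCast_lt_one_iff]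
    omega
  obtain ⟨r, hr⟩ := ThreeAdic.exists_sq_eq_of_norm_sub_one_lt u hlt
  exact ⟨r, by rw [hr, hu]⟩

/-- A natural number `m ≡ 2 (mod 3)` has `m/2` a square in `ℚ₃`. -/
theorem ThreeAdic.exists_sq_eq_half_of_mod_three (m : ℕ) (hm : m % 3 = 2) : ∃ r : ℚ_[3], r ^ 2 = (m : ℚ_[3]) / 2 := by
  have hle : ‖(m : ℚ_[3]) / 2‖ ≤ 1 := by
    rw [norm_div, norm_two, div_one]; exact_mod_cast Padic.norm_int_le_one (p := 3) m
  set u : ℤ_[3] := ⟨(m : ℚ_[3]) / 2, hle⟩ with hu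
  have hlt : ‖u - 1‖ < 1 := by
    rw [PadicInt.norm_def]
    have : ((u - 1 : ℤ_[3]) : ℚ_[3]) = ((m - 2 : ℤ) : ℚ_[3]) / 2 := by
      simp [hu]; field_simp
    rw [this, norm_div, norm_two, div_one, Padic.norm_intCast_lt_one_iff]
    omega
  obtain ⟨r, hr⟩ := ThreeAdic.exists_sq_eq_of_norm_sub_one_lt u hlt
  exact ⟨r, by rw [hr, hu]⟩

/-- PATTERN `⟨[3]⟩`: `d ≡ 1 (mod 3)` or `d ≡ 3 (mod 9)` ⇒ `√d ∈ ℚ₃(√3)`. -/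
theorem ThreeAdic.exists_sq_eq_frame3 (d : ℕ) (hd : d % 3 = 1 ∨ d % 9 = 3) :
    ∃ w ∈ frame3.L, w ^ 2 = (d : Ω₃) := by
  have mg : frame3.g ∈ frame3.L := mem_adjoin_simple_self _ _
  rcases hd with h1 | h3
  · obtain ⟨r, hr⟩ := ThreeAdic.exists_sq_eq_nat_of_mod_three d h1
    refine ⟨algebraMap ℚ_[3] Ω₃ r, IntermediateField.algebraMap_mem _ _, ?_⟩
    rw [← map_pow, hr, map_natCast]
  · obtain ⟨r, hr⟩ := ThreeAdic.exists_sq_eq_nat_of_mod_three (d / 3) (by omega)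
    refine ⟨algebraMap ℚ_[3] Ω₃ r * frame3.g, mul_mem (IntermediateField.algebraMap_mem _ _) mg, ?_⟩
    have hd3 : (d : Ω₃) = 3 * ((d / 3 : ℕ) : Ω₃) := by
      have : d = 3 * (d / 3) := by omega
      conv_lhs => rw [this]
      push_cast; ring
    rw [mul_pow, ← map_pow, hr, map_natCast, frame3_g_sq, hd3]; ring

/-- PATTERN `⟨[6]⟩`: `d ≡ 1 (mod 3)` or `d ≡ 6 (mod 9)` ⇒ `√d ∈ ℚ₃(√6)`. -/
theorem ThreeAdic.exists_sq_eq_frame6 (d : ℕ) (hd : d % 3 = 1 ∨ d % 9 = 6) :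
    ∃ w ∈ frame6.L, w ^ 2 = (d : Ω₃) := by
  have mg : frame6.g ∈ frame6.L := mem_adjoin_simple_self _ _
  rcases hd with h1 | h6
  · obtain ⟨r, hr⟩ := ThreeAdic.exists_sq_eq_nat_of_mod_three d h1
    refine ⟨algebraMap ℚ_[3] Ω₃ r, IntermediateField.algebraMap_mem _ _, ?_⟩
    rw [← map_pow, hr, map_natCast]
  · obtain ⟨r, hr⟩ := ThreeAdic.exists_sq_eq_half_of_mod_three (d / 3) (by omega)
    refine ⟨algebraMap ℚ_[3] Ω₃ r * frame6.g, mul_mem (IntermediateField.algebraMap_mem _ _) mg, ?_⟩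
    have hd3 : (d : Ω₃) = 3 * ((d / 3 : ℕ) : Ω₃) := by
      have : d = 3 * (d / 3) := by omega
      conv_lhs => rw [this]
      push_cast; ring
    rw [mul_pow, ← map_pow, hr, map_div₀, map_natCast, map_ofNat, frame6_g_sq, hd3]; ring

/-! ## The criterion -/

/-- A (fixed, arbitrary) `ℚ`-embedding `ℚ(√d : d ∈ S) → Ω₃`. -/
def multiSqrtEmbed₃ (S : Finset ℕ) : multiSqrtField S →ₐ[ℚ] Ω₃ := IsAlgClosed.lift

/-- THREE COLOURS through a frame: if every `√d`, `d ∈ S`, lies in `L = ℚ₃(g)`, every graph with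
`ℚ(√d : d ∈ S)`-coordinates and unit-quadrance edges is `3`-colourable. -/
theorem colorable_three_of_frame (F : ThreeAdic.Frame) (S : Finset ℕ) (hroots : ∀ d ∈ S, ∃ w ∈ F.L, w ^ 2 = (d : Ω₃))
    {V : Type*} {G : SimpleGraph V} (x y : V → multiSqrtField S)
    (hadj : ∀ ⦃v w : V⦄, G.Adj v w → (x v - x w) ^ 2 + (y v - y w) ^ 2 = 1) : G.Colorable 3 := by
  have hmem : ∀ t, (multiSqrtEmbed₃ S).toRingHom t ∈ F.L :=
    fun t => multiSqrtEmbed_mem_of_roots S (multiSqrtEmbed₃ S) F.L hroots t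
  set ψ : multiSqrtField S →+* F.L := (multiSqrtEmbed₃ S).toRingHom.codRestrict F.L hmem with hψ
  refine F.colorable_three (fun v => ψ (x v)) (fun v => ψ (y v)) ?_
  intro v w hvw
  have := congrArg ψ (hadj hvw)
  simpa [map_add, map_sub, map_pow] using this

/-- The two 3-adic patterns of a finite `S ⊂ ℕ`: the generated subgroup of `ℚ₃^×/ℚ₃^{×2}` avoids the unramified class
`[−1] = [2]`, i.e. `K_S ⊂ ℚ₃(√3)` (all `d ≡ 1 mod 3` or `≡ 3 mod 9`) or `K_S ⊂ ℚ₃(√6)` (all `d ≡ 1 mod 3` or `≡ 6 mod 9`). -/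
def ThreeAdicPattern (S : Finset ℕ) : Prop :=
  (∀ d ∈ S, d % 3 = 1 ∨ d % 9 = 3) ∨ (∀ d ∈ S, d % 3 = 1 ∨ d % 9 = 6)

/-- The 3-adic patterns are decidable (`decide` for concrete `S`). -/
instance (S : Finset ℕ) : Decidable (ThreeAdicPattern S) := by
  unfold ThreeAdicPattern; infer_instance

/-- THE 3-ADIC CRITERION (kernel).  If `S` fits a 3-adic pattern, every graph with `ℚ(√d : d ∈ S)`-coordinates and
unit-quadrance edges is `3`-colourable. -/
theorem colorable_three_of_threeAdicPattern (S : Finset ℕ) (hS : ThreeAdicPattern S)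
    {V : Type*} {G : SimpleGraph V} (x y : V → multiSqrtField S)
    (hadj : ∀ ⦃v w : V⦄, G.Adj v w → (x v - x w) ^ 2 + (y v - y w) ^ 2 = 1) : G.Colorable 3 := by
  rcases hS with h | h
  · exact colorable_three_of_frame frame3 S (fun d hd => ThreeAdic.exists_sq_eq_frame3 d (h d hd)) x y hadj
  · exact colorable_three_of_frame frame6 S (fun d hd => ThreeAdic.exists_sq_eq_frame6 d (h d hd)) x y hadj

/-- Realisation form: a unit-distance graph in the plane with all coordinates in `ℚ(√d : d ∈ S)`, `S` in a 3-adic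
pattern, is `3`-colourable. -/
theorem colorable_three_of_realisation_threeAdic (S : Finset ℕ) (hS : ThreeAdicPattern S)
    {V : Type*} {G : SimpleGraph V} {p : V → EuclideanSpace ℝ (Fin 2)} (hp : IsUnitDistanceRealisation G p)
    (hK : ∀ v i, p v i ∈ multiSqrtField S) : G.Colorable 3 := by
  refine colorable_three_of_threeAdicPattern S hS (G := G) (fun v => ⟨p v 0, hK v 0⟩) (fun v => ⟨p v 1, hK v 1⟩) ?_
  intro v w hvw
  apply Subtype.ext
  push_cast
  exact sq_add_sq_eq_one_of_dist_eq_one (hp.2 hvw)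

/-- `unitCircleGraph` form: `χ(K_S²) ≤ 3`. -/
theorem colorable_three_unitCircleGraph_threeAdic (S : Finset ℕ) (hS : ThreeAdicPattern S) :
    (unitCircleGraph (multiSqrtField S)).Colorable 3 :=
  colorable_three_of_threeAdicPattern S hS (G := unitCircleGraph (multiSqrtField S)) Prod.fst Prod.snd fun _ _ h => h.2

/-- Plane form: `χ(K_S²) ≤ 3`. -/
theorem colorable_three_plane_threeAdic (S : Finset ℕ) (hS : ThreeAdicPattern S) :
    (planeUnitDistanceGraph.induce (fieldPoints (multiSqrtField S))).Colorable 3 :=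
  colorable_three_of_realisation_threeAdic S hS (isUnitDistanceRealisation_fieldPoints _) fun q i => q.2 i

/-- Census consequence: a unit-distance graph that is NOT `3`-colourable (e.g. one containing a Moser spindle; every
5-chromatic one) has a coordinate outside `ℚ(√d : d ∈ S)` for every 3-adic pattern `S`. -/
theorem leaves_threeAdic_fields {V : Type*} {G : SimpleGraph V} {p : V → EuclideanSpace ℝ (Fin 2)}
    (hp : IsUnitDistanceRealisation G p) (h3 : ¬ G.Colorable 3) (S : Finset ℕ) (hS : ThreeAdicPattern S) :
    ∃ v i, p v i ∉ multiSqrtField S := by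
  by_contra hall
  push Not at hall
  exact h3 (colorable_three_of_realisation_threeAdic S hS hp hall)

/-! ## Exact value three -/

/-- `χ(K_S²) = 3` EXACTLY when `S` fits a 3-adic pattern and `√3 ∈ K_S`. -/
theorem chromaticNumber_plane_eq_three (S : Finset ℕ) (hS : ThreeAdicPattern S) (h3 : Real.sqrt 3 ∈ multiSqrtField S) :
    (planeUnitDistanceGraph.induce (fieldPoints (multiSqrtField S))).chromaticNumber = 3 := by
  rw [show (3 : ℕ∞) = (2 : ℕ) + 1 by norm_num]
  exact chromaticNumber_eq_iff_colorable_not_colorable.mpr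
    ⟨colorable_three_plane_threeAdic S hS, not_colorable_two_plane_of_sqrt3_mem _ h3⟩

/-- In particular `χ(ℚ(√d : d ∈ S)²) = 3` whenever `3 ∈ S` and all `d ∈ S` are `≡ 1 (mod 3)` or `≡ 3 (mod 9)`. -/
theorem chromaticNumber_plane_eq_three_of_mem (S : Finset ℕ) (hS : ∀ d ∈ S, d % 3 = 1 ∨ d % 9 = 3) (h3 : 3 ∈ S) :
    (planeUnitDistanceGraph.induce (fieldPoints (multiSqrtField S))).chromaticNumber = 3 :=
  chromaticNumber_plane_eq_three S (Or.inl hS) (by simpa using sqrt_mem_multiSqrtField (S := S) (d := 3) h3)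

/-- MADORE 2015 (arXiv:1509.07023, `χ(ℚ(√3)²) = 3`; kernel replication): the unit-distance graph of `ℚ(√3)²` has
chromatic number exactly `3`. -/
theorem chromaticNumber_plane_sqrt3 :
    (planeUnitDistanceGraph.induce (fieldPoints ℚ⟮Real.sqrt 3⟯)).chromaticNumber = 3 := by
  have h := chromaticNumber_plane_eq_three_of_mem {3} (by decide) (by decide)
  rwa [multiSqrtField_singleton, Nat.cast_ofNat] at h

/-- FISCHER 1990 (the 3-adic case; kernel replication, as quoted in Payne 2009 arXiv:0707.1177 p. 6: square-free
`n ≡ 0, 1 (mod 3)`): `χ(ℚ(√n)²) ≤ 3` for every `n ≡ 1 (mod 3)` and every `n ≡ 3, 6 (mod 9)`. -/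
theorem colorable_three_plane_quadratic (n : ℕ) (hn : n % 3 = 1 ∨ n % 9 = 3 ∨ n % 9 = 6) :
    (planeUnitDistanceGraph.induce (fieldPoints ℚ⟮Real.sqrt n⟯)).Colorable 3 := by
  rw [← multiSqrtField_singleton]
  apply colorable_three_plane_threeAdic
  unfold ThreeAdicPattern
  simp only [Finset.mem_singleton, forall_eq]
  omega

/-- Beyond print: `χ(ℚ(√3, √7)²) = 3` (the 2-adic criterion does not apply: `[7] = [−1]` in `ℚ₂`). -/
theorem chromaticNumber_plane_sqrt3_sqrt7 :
    (planeUnitDistanceGraph.induce (fieldPoints (multiSqrtField {3, 7}))).chromaticNumber = 3 :=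
  chromaticNumber_plane_eq_three_of_mem _ (by decide) (by decide)

/-- Beyond print: `χ(ℚ(√3, √7, √13, √19, √21, √31, √37)²) = 3`. -/
theorem chromaticNumber_plane_example_frame3 :
    (planeUnitDistanceGraph.induce (fieldPoints (multiSqrtField {3, 7, 13, 19, 21, 31, 37}))).chromaticNumber = 3 :=
  chromaticNumber_plane_eq_three_of_mem _ (by decide) (by decide)

/-- Beyond print: `χ(ℚ(√6, √7, √15, √33)²) ≤ 3` (pattern `⟨[6]⟩`). -/
theorem colorable_three_plane_example_frame6 :
    (planeUnitDistanceGraph.induce (fieldPoints (multiSqrtField {6, 7, 15, 33}))).Colorable 3 :=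
  colorable_three_plane_threeAdic _ (by decide)

/-! ## Summary -/

/-- THE 3-ADIC CRITERION, ONE CONJUNCTION FOR THE TABLE.  (i) `χ(K_S²) ≤ 3` for every `S` in a 3-adic pattern; (ii) `= 3`
when moreover `√3 ∈ K_S`; (iii) `χ(ℚ(√3)²) = 3` (Madore 2015) and `χ(ℚ(√n)²) ≤ 3` for `n ≡ 1 (mod 3)` or `n ≡ 3, 6 (mod 9)`
(Fischer 1990); (iv) every unit-distance graph that is not `3`-colourable has a coordinate outside every such `K_S`. -/
theorem threeAdic_criterion_summary :
    (∀ S : Finset ℕ, ThreeAdicPattern S → (planeUnitDistanceGraph.induce (fieldPoints (multiSqrtField S))).Colorable 3) ∧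
    (∀ S : Finset ℕ, ThreeAdicPattern S → Real.sqrt 3 ∈ multiSqrtField S →
        (planeUnitDistanceGraph.induce (fieldPoints (multiSqrtField S))).chromaticNumber = 3) ∧
    (planeUnitDistanceGraph.induce (fieldPoints ℚ⟮Real.sqrt 3⟯)).chromaticNumber = 3 ∧
    (∀ n : ℕ, n % 3 = 1 ∨ n % 9 = 3 ∨ n % 9 = 6 →
        (planeUnitDistanceGraph.induce (fieldPoints ℚ⟮Real.sqrt n⟯)).Colorable 3) ∧
    (∀ (V : Type) (G : SimpleGraph V) (p : V → EuclideanSpace ℝ (Fin 2)), IsUnitDistanceRealisation G p →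
        ¬ G.Colorable 3 → ∀ S : Finset ℕ, ThreeAdicPattern S → ∃ v i, p v i ∉ multiSqrtField S) :=
  ⟨colorable_three_plane_threeAdic, chromaticNumber_plane_eq_three, chromaticNumber_plane_sqrt3,
    colorable_three_plane_quadratic, fun _ _ _ hp h3 => leaves_threeAdic_fields hp h3⟩

end Summit.Ventures.DiscreteObjects.UnitDistance
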